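import Mathlib
import HarnessLib
import Summits.Ventures.LatticeQCDFlow.Scaling.TorusDiagonalLimit2D
import Summits.Ventures.LatticeQCDFlow.Scaling.LossDiagonalRate

/-!
# LatticeQCDFlow / Scaling — RATES ON THE TORUS: for every `L ≥ 2` and every small coupling, the untrained
# sampler's reverse loss and log-ESS on the periodic `L × L` torus are `(L² − 1)β²σ²/2` and
# `−(L² − 1)β²σ²` up to EXPLICIT errors `4|β|N + 2(L² − 1)|β|³(2N)³`, `8|β|N + 20(L² − 1)|β|³(2N)³`

HONEST FRAMING: exact (Metropolis-corrected) sampling algorithms for lattice gauge theory;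
figures of merit are autocorrelation/cost numbers at stated couplings and volumes; no
continuum-physics claim.

Venture `LatticeQCDFlow` (cell pub-lqcd), topic `Scaling`; FANOUT row 3 (`s0-u1-a`, S0-B
implementation A, GEN-21).  NEW WORK of the cell, no numerics, NO definition.  The limit theorems of
`Scaling/TorusDiagonalLimit2D`, `TorusWindowEssLoss2D` say WHERE the torus loss and ESS go; this file says
HOW FAST, non-asymptotically, for every volume at once: GEN-21's torus sandwiches
(`Scaling/TorusEssLossSandwich2D`: `|D − (L²−1)ℓ(β)| ≤ 4|β|N`, `ESS_T ∈ e^{±8|β|N}(z²/z(2·))^{L²−1}`), the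
centring identities of `Scaling/TorusDiagonalLimit2D` (`ℓ = cgf_X`, `z²/z(2·) = M_X²/M_X(2·)`,
`X = Re tr ρ − m`, `|X| ≤ 2N`) and GEN-20's second-order rates (`Scaling/LossDiagonalRate`:
`|cgf(u) − u²σ²/2| ≤ 2|u|³K³` for `|u|K ≤ 1/2`, `|2cgf(β) − cgf(2β) + β²σ²| ≤ 20|β|³K³` for `|β|K ≤ 1/4`,
`K = 2N`) combine by the triangle inequality:

* **`torus_reverseKL_rate`** — `|β|·2N ≤ 1/2 ⇒ |D(Haar^{⊗E} ‖ Wilson_β) − (L²−1)β²σ²/2| ≤ 4|β|N + 2(L²−1)|β|³(2N)³`;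
* **`torus_logEssFrac_rate`** — `|β|·2N ≤ 1/4 ⇒ |log ESS_T(β) + (L²−1)β²σ²| ≤ 8|β|N + 20(L²−1)|β|³(2N)³`;

`σ² = Var_Haar(Re tr ρ)`, every compact second-countable `G`, continuous `ρ`, `L ≥ 2`.  On the diagonal
`β = c/L` both errors are `O(1/L)` — the first RATE statements for a torus figure of merit in the tree.
NOT CLAIMED: a rate for the acceptance (none is known for the factorised model either); sharper constants;
`d ≥ 3`; any value at the cell's `(β, L)`; nothing re-scored, SEALED.md untouched.
-/

noncomputable section

namespace Summit.Ventures.LatticeQCDFlow.Theory2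

open MeasureTheory ProbabilityTheory Filter Finset Real Set
open Literature.MathematicalPhysics.QuantumFieldTheory
open scoped Topology

variable {L N : ℕ} {G : Type*} [Group G] [TopologicalSpace G] [IsTopologicalGroup G]
  [CompactSpace G] [SecondCountableTopology G] [MeasurableSpace G] [BorelSpace G]
  (ρ : G →* Matrix (Fin N) (Fin N) ℂ)

/-- **RATE FOR THE TORUS REVERSE LOSS**: for `L ≥ 2`, every compact second-countable `G`, continuous `ρ`
and every coupling with `|β|·2N ≤ 1/2`,
`|D(Haar^{⊗E} ‖ Wilson_β) − (L² − 1)·β²σ²/2| ≤ 4|β|N + 2(L² − 1)|β|³(2N)³`, `σ² = Var_Haar(Re tr ρ)`. [ours] -/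
theorem torus_reverseKL_rate [NeZero L] (hL : 2 ≤ L) (hρ : Continuous ρ) {β : ℝ}
    (hβ : |β| * (2 * N) ≤ 1 / 2) :
    |∫ U, Real.log (1 / (Real.exp (-β * wilsonAction ρ U) /
          ∫ V, Real.exp (-β * wilsonAction ρ V) ∂(Measure.pi fun _ : Edge 2 L => haarProbability G)))
          ∂(Measure.pi fun _ : Edge 2 L => haarProbability G) -
        ((L ^ 2 - 1 : ℕ) : ℝ) * (β ^ 2 * Var[fun g : G => (ρ g).trace.re; haarProbability G] / 2)| ≤
      4 * |β| * N + 2 * ((L ^ 2 - 1 : ℕ) : ℝ) * |β| ^ 3 * (2 * N) ^ 3 := by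
  obtain ⟨hXm, hXb, hX0, hVar⟩ := centredTrace_facts ρ hρ
  set m : ℝ := ∫ h, (ρ h).trace.re ∂(haarProbability G) with hm
  have h1 := torus_reverseKL_sandwich ρ hL hρ β
  rw [oneplaquette_loss_eq_cgf ρ hρ β] at h1
  have h2 := abs_cgf_sub_le (haarProbability G) hXm hXb hX0 (u := β) hβ
  rw [hVar] at h2
  have hn : 0 ≤ ((L ^ 2 - 1 : ℕ) : ℝ) := Nat.cast_nonneg _
  have h3 : |((L ^ 2 - 1 : ℕ) : ℝ) * cgf (fun g : G => (ρ g).trace.re - m) (haarProbability G) β -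
      ((L ^ 2 - 1 : ℕ) : ℝ) * (β ^ 2 * Var[fun g : G => (ρ g).trace.re; haarProbability G] / 2)| ≤
      ((L ^ 2 - 1 : ℕ) : ℝ) * (2 * |β| ^ 3 * (2 * N) ^ 3) := by
    rw [← mul_sub, abs_mul, abs_of_nonneg hn]
    exact mul_le_mul_of_nonneg_left h2 hn
  calc _ ≤ |∫ U, Real.log (1 / (Real.exp (-β * wilsonAction ρ U) /
            ∫ V, Real.exp (-β * wilsonAction ρ V) ∂(Measure.pi fun _ : Edge 2 L => haarProbability G)))
            ∂(Measure.pi fun _ : Edge 2 L => haarProbability G) -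
          ((L ^ 2 - 1 : ℕ) : ℝ) * cgf (fun g : G => (ρ g).trace.re - m) (haarProbability G) β| +
        |((L ^ 2 - 1 : ℕ) : ℝ) * cgf (fun g : G => (ρ g).trace.re - m) (haarProbability G) β -
          ((L ^ 2 - 1 : ℕ) : ℝ) * (β ^ 2 * Var[fun g : G => (ρ g).trace.re; haarProbability G] / 2)| :=
        abs_sub_le _ _ _
    _ ≤ 4 * |β| * N + ((L ^ 2 - 1 : ℕ) : ℝ) * (2 * |β| ^ 3 * (2 * N) ^ 3) := add_le_add h1 h3
    _ = _ := by ring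

/-- **RATE FOR THE TORUS LOG-ESS**: for `L ≥ 2`, every compact second-countable `G`, continuous `ρ` and every
coupling with `|β|·2N ≤ 1/4`, the Kish fraction `ESS_T = (∫p)²/∫p²` of the untrained sampler on the
periodic `L × L` torus obeys `|log ESS_T + (L² − 1)·β²σ²| ≤ 8|β|N + 20(L² − 1)|β|³(2N)³`. [ours] -/
theorem torus_logEssFrac_rate [NeZero L] (hL : 2 ≤ L) (hρ : Continuous ρ) {β : ℝ}
    (hβ : |β| * (2 * N) ≤ 1 / 4) :
    |Real.log ((∫ U, Real.exp (-β * wilsonAction ρ U) / ∫ V, Real.exp (-β * wilsonAction ρ V)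
              ∂(Measure.pi fun _ : Edge 2 L => haarProbability G)
            ∂(Measure.pi fun _ : Edge 2 L => haarProbability G)) ^ 2 /
          ∫ U, (Real.exp (-β * wilsonAction ρ U) / ∫ V, Real.exp (-β * wilsonAction ρ V)
              ∂(Measure.pi fun _ : Edge 2 L => haarProbability G)) ^ 2
            ∂(Measure.pi fun _ : Edge 2 L => haarProbability G)) +
        ((L ^ 2 - 1 : ℕ) : ℝ) * (β ^ 2 * Var[fun g : G => (ρ g).trace.re; haarProbability G])| ≤
      8 * |β| * N + 20 * ((L ^ 2 - 1 : ℕ) : ℝ) * |β| ^ 3 * (2 * N) ^ 3 := by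
  obtain ⟨hXm, hXb, hX0, hVar⟩ := centredTrace_facts ρ hρ
  set m : ℝ := ∫ h, (ρ h).trace.re ∂(haarProbability G) with hm
  have hb : ∀ᵐ g ∂(haarProbability G), (ρ g).trace.re - m ∈ Set.Icc (-(2 * (N : ℝ))) (2 * N) :=
    ae_of_all _ fun g => abs_le.1 (hXb g)
  have hiE : ∀ t : ℝ, Integrable (fun g : G => Real.exp (t * ((ρ g).trace.re - m))) (haarProbability G) :=
    fun t => integrable_exp_mul_of_mem_Icc hXm.aemeasurable hb
  -- the factorised rate in cumulant form: `(M²/M(2·))^n = exp(n(2cgf − cgf(2·)))`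
  have hsw := torus_essFrac_sandwich ρ hL hρ β
  rw [oneplaquette_ratio_eq_mgf ρ hρ β] at hsw
  have hform : (mgf (fun g : G => (ρ g).trace.re - m) (haarProbability G) β ^ 2 /
        mgf (fun g : G => (ρ g).trace.re - m) (haarProbability G) (2 * β)) ^ (L ^ 2 - 1) =
      Real.exp (((L ^ 2 - 1 : ℕ) : ℝ) * (2 * cgf (fun g : G => (ρ g).trace.re - m) (haarProbability G) β -
        cgf (fun g : G => (ρ g).trace.re - m) (haarProbability G) (2 * β))) := by
    have hk : mgf (fun g : G => (ρ g).trace.re - m) (haarProbability G) β ^ 2 /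
        mgf (fun g : G => (ρ g).trace.re - m) (haarProbability G) (2 * β) =
        Real.exp (2 * cgf (fun g : G => (ρ g).trace.re - m) (haarProbability G) β -
          cgf (fun g : G => (ρ g).trace.re - m) (haarProbability G) (2 * β)) := by
      rw [← exp_cgf (hiE β), ← exp_cgf (hiE (2 * β)), Real.exp_sub,
        show (2 : ℝ) * cgf (fun g : G => (ρ g).trace.re - m) (haarProbability G) β =
          ((2 : ℕ) : ℝ) * cgf (fun g : G => (ρ g).trace.re - m) (haarProbability G) β by norm_num,
        Real.exp_nat_mul]
    rw [hk, ← Real.exp_nat_mul]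
  rw [hform] at hsw
  set E : ℝ := (∫ U, Real.exp (-β * wilsonAction ρ U) / ∫ V, Real.exp (-β * wilsonAction ρ V)
        ∂(Measure.pi fun _ : Edge 2 L => haarProbability G)
      ∂(Measure.pi fun _ : Edge 2 L => haarProbability G)) ^ 2 /
    ∫ U, (Real.exp (-β * wilsonAction ρ U) / ∫ V, Real.exp (-β * wilsonAction ρ V)
        ∂(Measure.pi fun _ : Edge 2 L => haarProbability G)) ^ 2
      ∂(Measure.pi fun _ : Edge 2 L => haarProbability G) with hE
  set A : ℝ := ((L ^ 2 - 1 : ℕ) : ℝ) * (2 * cgf (fun g : G => (ρ g).trace.re - m) (haarProbability G) β -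
    cgf (fun g : G => (ρ g).trace.re - m) (haarProbability G) (2 * β)) with hA
  -- `|log E − A| ≤ 8|β|N`
  have hEpos : 0 < E := lt_of_lt_of_le (mul_pos (Real.exp_pos _) (Real.exp_pos _)) hsw.1
  have hlog : |Real.log E - A| ≤ 8 * |β| * N := by
    rw [abs_le]
    constructor
    · have h := Real.log_le_log (mul_pos (Real.exp_pos _) (Real.exp_pos _)) hsw.1
      rw [Real.log_mul (Real.exp_pos _).ne' (Real.exp_pos _).ne', Real.log_exp, Real.log_exp] at h
      linarith
    · have h := Real.log_le_log hEpos hsw.2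
      rw [Real.log_mul (Real.exp_pos _).ne' (Real.exp_pos _).ne', Real.log_exp, Real.log_exp] at h
      linarith
  -- `|A + nβ²σ²| ≤ 20 n |β|³ K³`
  have h2 := abs_log_essFrac_add_le (haarProbability G) hXm hXb hX0 (β := β) hβ
  rw [hVar] at h2
  have hn : 0 ≤ ((L ^ 2 - 1 : ℕ) : ℝ) := Nat.cast_nonneg _
  have h3 : |A + ((L ^ 2 - 1 : ℕ) : ℝ) * (β ^ 2 * Var[fun g : G => (ρ g).trace.re; haarProbability G])| ≤
      ((L ^ 2 - 1 : ℕ) : ℝ) * (20 * |β| ^ 3 * (2 * N) ^ 3) := by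
    rw [hA, ← mul_add, abs_mul, abs_of_nonneg hn]
    exact mul_le_mul_of_nonneg_left h2 hn
  calc |Real.log E + ((L ^ 2 - 1 : ℕ) : ℝ) * (β ^ 2 * Var[fun g : G => (ρ g).trace.re; haarProbability G])|
      = |(Real.log E - A) +
          (A + ((L ^ 2 - 1 : ℕ) : ℝ) * (β ^ 2 * Var[fun g : G => (ρ g).trace.re; haarProbability G]))| := by
        ring_nf
    _ ≤ |Real.log E - A| +
          |A + ((L ^ 2 - 1 : ℕ) : ℝ) * (β ^ 2 * Var[fun g : G => (ρ g).trace.re; haarProbability G])| :=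
        abs_add_le _ _
    _ ≤ 8 * |β| * N + ((L ^ 2 - 1 : ℕ) : ℝ) * (20 * |β| ^ 3 * (2 * N) ^ 3) := add_le_add hlog h3
    _ = _ := by ring

end Summit.Ventures.LatticeQCDFlow.Theory2

end
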